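import Summits.HodgeConjecture.HodgeConjecture.Theorems.MarkmanPartnerTransportPartnerTransportIsometryThird
import Summits.HodgeConjecture.HodgeConjecture.Theorems.MarkmanPartnerTransportK3Sq2TypeHodgeOfPicardThree
import Summits.HodgeConjecture.HodgeConjecture.Theorems.MarkmanPartnerTransportPicardThreeK3SquaresCycleInducedSector
import Summits.HodgeConjecture.HodgeConjecture.Theorems.MarkmanPartnerTransportPicardThreeK3SquaresTranscendentalBuskin

/-!
# Route MarkmanPartnerTransport · support #3 `IsometrySpannedThird` (stmt-HodgeConjecture-19651) —
# PROVED AT PICARD RANK `≥ 4` modulo six published named facts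

`IsometrySpannedThird` asserts: a marked smooth projective `K3^{[2]}`-type fourfold `X` whose rational
Hodge endomorphisms of `T(X)` are `ℚ`-combinations of Hodge isometries (`SpannedByIsometries X φ` — the
thirds `End_Hdg T(X) = ℚ` and `End_Hdg T(X)` CM of Zarhin's trichotomy) satisfies `HC⁴(X)`.  Here it is
proved for `ρ(X) ≥ 4`, PARTNER-WISE instead of by recipe B (graphs on `X × X`):

* `hodgeConjectureFor_of_spannedByIsometries_of_four_le` — **(six facts) → for marked `X` with
  `ρ(X) ≥ 4` and `SpannedByIsometries X φ`, `HC⁴(X)`**, modulo {`Huybrechts_K3_periodSurjective_projective`,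
  `Beauville1983_hilbertSquare_markedIncidence`, `HilbertScheme.Beauville1983_hilbertSquare_blowupDiagonal_surjection`,
  `Markman2024_rationalHodgeIsometry_lift_algebraic_marked`, `Voisin2003_cupProduct_algebraicClasses`,
  `Buskin2019_hodgeIsometry_algebraic`}.

Proof: partner `(S, g)` (`PartnerExistence`); «spanned by isometries» descends to the cycle-induced
sector clause of `S` (`cycleInducedSector_of_partner_of_spannedByIsometries`, with Huybrechts 2019
Cor. 0.4 (i) supplied by `NikulinIsogeny.transcendentalHodgeIsometry_algebraic_of_buskin`); the tree's
`CycleInducedSector.hodgeConjectureFor_square_of_cycleInducedSector` gives `HC⁴(S × S)`; `PartnerTransport`.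
With `hodgeConjectureFor_of_picardThreeK3Squares_of_four_le` this leaves, at `ρ(X) ≥ 4`, exactly the
REAL-MULTIPLICATION third of the crux `PicardThreeK3Squares`; the items #3/#5 of `closes` are needed
unconditionally only at `ρ(X) ≤ 3`.  CONDITIONAL (credits nothing).  No definition, no sorry.
Prover seat hodge-nonav-19652-p1 (gen 6), `--supports stmt-HodgeConjecture-19651`.

References: E. Markman, Compos. Math. 160 (2024) Thm. 1.1/1.4; N. Buskin, J. reine angew. Math. 755 (2019)
Thm. 1.1; D. Huybrechts, Comment. Math. Helv. 94 (2019) Cor. 0.4; Yu. Zarhin, J. reine angew. Math. 341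
(1983) Thm. 1.5.1; A. Beauville, J. Differential Geom. 18 (1983) §6–9.
-/

noncomputable section

set_option linter.dupNamespace false

open Module CategoryTheory MonoidalCategory
open Literature.AlgebraicTopology.SingularHomology
open Literature.AlgebraicGeometry Literature.AlgebraicGeometry.Motives Literature.AlgebraicGeometry.HodgeTheory
open Literature.AlgebraicGeometry.Hyperkaehler Literature.AlgebraicGeometry.Surfaces
open Literature.AlgebraicGeometry.HilbertScheme
open Summit.HodgeConjecture.HodgeConjecture.Theorems.NikulinTwinTransport
open Summit.HodgeConjecture.HodgeConjecture.Theorems.MarkmanPartnerTransport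

namespace Summit.HodgeConjecture.HodgeConjecture.Theorems.MarkmanPartnerTransport.PartnerLattice

/-- `MarkedK3Sq[X, φ, P, z]`: VERBATIM the `let MarkedK3Sq := …` binder of the route declarations of
MarkmanPartnerTransport (clauses (m1)–(m6)). Local notation only. -/
local notation3 (prettyPrint := false) "MarkedK3Sq[" X ", " φ ", " P ", " z "]" =>
  (((IsIntegralClass P ∧ ∀ Q : complexBetti X (2 * 4), IsIntegralClass Q → ∃ n : ℤ, Q = n • P) ∧
    (∀ c : complexBetti X 2, IsIntegralClass c ↔ ∃ v : K3HilbertIndex → ℤ, φ c = fun i => (v i : ℂ)) ∧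
    (∀ a : complexBetti X 2, cupPowTwo a 4 = ((3 : ℂ) * (k3HilbertForm 2 (φ a) (φ a)) ^ 2) • P) ∧
    (IsOfHodgeType 4 X 2 2 0 (LinearEquiv.symm φ z) ∧
      ∀ τ : complexBetti X 2, IsOfHodgeType 4 X 2 2 0 τ → ∃ t : ℂ, τ = t • LinearEquiv.symm φ z) ∧
    (∀ c : complexBetti X 2, IsOfHodgeType 4 X 2 1 1 c ↔
      (k3HilbertForm 2 (φ c) z = 0 ∧ k3HilbertForm 2 (φ c) (star z) = 0)) ∧
    (k3HilbertForm 2 z z = 0 ∧ 0 < (k3HilbertForm 2 (star z) z).re)))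

/-- **`IsometrySpannedThird` at `ρ(X) ≥ 4`, modulo six published named facts** (module docstring):
for a marked smooth projective `K3^{[2]}`-type fourfold `X` with `ρ(X) ≥ 4` whose rational Hodge
endomorphisms of `H²(X)` killing `N¹(X)` with `q`-transcendental image are, on `T(X)`, `ℚ`-combinations of
bijective rational Hodge `q`-isometries, `HC⁴(X)` holds. [cite: Markman2024, §1.1 Thm. 1.1 and Thm. 1.4]
[cite: Buskin2019, Thm. 1.1] [cite: Huybrechts2019, Cor. 0.4 (i)] [cite: Zarhin1983HodgeGroupsK3, Thm. 1.5.1] -/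
theorem hodgeConjectureFor_of_spannedByIsometries_of_four_le
    (hP : Huybrechts_K3_periodSurjective_projective) (hB : Beauville1983_hilbertSquare_markedIncidence)
    (hρ : Beauville1983_hilbertSquare_blowupDiagonal_surjection)
    (hMk : Markman2024_rationalHodgeIsometry_lift_algebraic_marked)
    (hcup : Voisin2003_cupProduct_algebraicClasses) (hBu : Buskin2019_hodgeIsometry_algebraic)
    {X : SchemeOver ℂ} (hX : IsSmoothProjective 4 X) (hK : IsOfK3HilbertSquareType X)
    {φ : complexBetti X 2 ≃ₗ[ℂ] (K3HilbertIndex → ℂ)} {P : complexBetti X (2 * 4)} {z : K3HilbertIndex → ℂ}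
    (hM : MarkedK3Sq[X, φ, P, z]) (h4 : 4 ≤ Module.finrank ℂ (algebraicClasses X 1))
    (hSp : ∀ f : complexBetti X 2 →ₗ[ℂ] complexBetti X 2,
      (∀ y, IsRationalClass y → IsRationalClass (f y)) →
      (∀ (i j : ℕ) y, IsOfHodgeType 4 X 2 i j y → IsOfHodgeType 4 X 2 i j (f y)) →
      (∀ d : complexBetti X 2, d ∈ algebraicClasses X 1 → f d = 0) →
      (∀ y : complexBetti X 2, ∀ d : complexBetti X 2, d ∈ algebraicClasses X 1 →
        k3HilbertForm 2 (φ (f y)) (φ d) = 0) →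
      ∃ (k : ℕ) (c : Fin k → ℚ) (gX : Fin k → (complexBetti X 2 →ₗ[ℂ] complexBetti X 2)),
        (∀ i, Function.Bijective (gX i) ∧ (∀ y, IsRationalClass y → IsRationalClass (gX i y)) ∧
          (∀ (a b : ℕ) y, IsOfHodgeType 4 X 2 a b y → IsOfHodgeType 4 X 2 a b (gX i y)) ∧
          (∀ a b, k3HilbertForm 2 (φ (gX i a)) (φ (gX i b)) = k3HilbertForm 2 (φ a) (φ b))) ∧
        ∀ y : complexBetti X 2,
          (∀ d : complexBetti X 2, d ∈ algebraicClasses X 1 → k3HilbertForm 2 (φ y) (φ d) = 0) →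
          f y = ∑ i : Fin k, ((c i : ℂ) • gX i y)) :
    HodgeConjectureFor 4 X := by
  refine hodgeConjectureFor_of_square_partner hP hB hρ hMk hcup hX hK hM h4 ?_
  intro S hS η p x g hSm hg _
  have hμ := hasPoincareDuality_complexOrientationFamily
  obtain ⟨H, hH, Ξ, φH, PH, -, -, hMH, θ, hθ, hi⟩ :=
    hB complexOrientationFamily hμ S hS η p x hSm.2.1 hSm.2.2.1 hSm.2.2.2.1 hSm.2.2.2.2
  exact CycleInducedSector.hodgeConjectureFor_square_of_cycleInducedSector complexOrientationFamily
    hS.isSmoothProjective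
    (cycleInducedSector_of_partner_of_spannedByIsometries
      (NikulinIsogeny.transcendentalHodgeIsometry_algebraic_of_buskin hBu) hcup hX hM hS hSm hH hMH hθ hi
      hg.1 hg.2.1 hg.2.2.2.2.1 hSp)

/-- **The route declaration `IsometrySpannedThird` restricted to `ρ(X) ≥ 4`, modulo the six facts** —
literally `SpannedByIsometries X φ → 4 ≤ ρ(X) → HodgeConjectureFor 4 X` in the route's binders.
[cite: Markman2024, §1.1 Thm. 1.1 and Thm. 1.4] [cite: Buskin2019, Thm. 1.1] [cite: Huybrechts2019, Cor. 0.4 (i)] -/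
theorem isometrySpannedThird_of_four_le
    (hP : Huybrechts_K3_periodSurjective_projective) (hB : Beauville1983_hilbertSquare_markedIncidence)
    (hρ : Beauville1983_hilbertSquare_blowupDiagonal_surjection)
    (hMk : Markman2024_rationalHodgeIsometry_lift_algebraic_marked)
    (hcup : Voisin2003_cupProduct_algebraicClasses) (hBu : Buskin2019_hodgeIsometry_algebraic) :
    open Literature.AlgebraicGeometry Literature.AlgebraicGeometry.Motives Literature.AlgebraicGeometry.HodgeTheory
      Literature.AlgebraicGeometry.Hyperkaehler Literature.AlgebraicGeometry.Surfaces
      Literature.AlgebraicTopology.SingularHomology CategoryTheory in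
    let MarkedK3Sq := fun (X : SchemeOver ℂ) (φ : complexBetti X 2 ≃ₗ[ℂ] (K3HilbertIndex → ℂ))
      (P : complexBetti X (2 * 4)) (z : K3HilbertIndex → ℂ) =>
      ((IsIntegralClass P ∧ ∀ Q : complexBetti X (2 * 4), IsIntegralClass Q → ∃ n : ℤ, Q = n • P) ∧
        (∀ c : complexBetti X 2, IsIntegralClass c ↔ ∃ v : K3HilbertIndex → ℤ, φ c = fun i => (v i : ℂ)) ∧
        (∀ a : complexBetti X 2, cupPowTwo a 4 = ((3 : ℂ) * (k3HilbertForm 2 (φ a) (φ a)) ^ 2) • P) ∧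
        (IsOfHodgeType 4 X 2 2 0 (LinearEquiv.symm φ z) ∧ ∀ τ : complexBetti X 2,
          IsOfHodgeType 4 X 2 2 0 τ → ∃ t : ℂ, τ = t • LinearEquiv.symm φ z) ∧
        (∀ c : complexBetti X 2, IsOfHodgeType 4 X 2 1 1 c ↔
          (k3HilbertForm 2 (φ c) z = 0 ∧ k3HilbertForm 2 (φ c) (star z) = 0)) ∧
        (k3HilbertForm 2 z z = 0 ∧ 0 < (k3HilbertForm 2 (star z) z).re))
    let IsBBFTransc := fun (X : SchemeOver ℂ) (φ : complexBetti X 2 ≃ₗ[ℂ] (K3HilbertIndex → ℂ))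
      (y : complexBetti X 2) => ∀ d : complexBetti X 2, d ∈ algebraicClasses X 1 → k3HilbertForm 2 (φ y) (φ d) = 0
    let SpannedByIsometries := fun (X : SchemeOver ℂ) (φ : complexBetti X 2 ≃ₗ[ℂ] (K3HilbertIndex → ℂ)) =>
      ∀ f : complexBetti X 2 →ₗ[ℂ] complexBetti X 2, (∀ y, IsRationalClass y → IsRationalClass (f y)) →
        (∀ (i j : ℕ) y, IsOfHodgeType 4 X 2 i j y → IsOfHodgeType 4 X 2 i j (f y)) →
        (∀ d : complexBetti X 2, d ∈ algebraicClasses X 1 → f d = 0) →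
        (∀ y : complexBetti X 2, IsBBFTransc X φ (f y)) →
        ∃ (k : ℕ) (c : Fin k → ℚ) (g : Fin k → (complexBetti X 2 →ₗ[ℂ] complexBetti X 2)),
          (∀ i, Function.Bijective (g i) ∧ (∀ y, IsRationalClass y → IsRationalClass (g i y)) ∧
            (∀ (a b : ℕ) y, IsOfHodgeType 4 X 2 a b y → IsOfHodgeType 4 X 2 a b (g i y)) ∧
            (∀ a b, k3HilbertForm 2 (φ (g i a)) (φ (g i b)) = k3HilbertForm 2 (φ a) (φ b))) ∧
          ∀ y : complexBetti X 2, IsBBFTransc X φ y → f y = ∑ i : Fin k, ((c i : ℂ) • g i y)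
    ∀ (X : SchemeOver ℂ), IsSmoothProjective 4 X → IsOfK3HilbertSquareType X →
      ∀ (φ : complexBetti X 2 ≃ₗ[ℂ] (K3HilbertIndex → ℂ)) (P : complexBetti X (2 * 4)) (z : K3HilbertIndex → ℂ),
        MarkedK3Sq X φ P z → SpannedByIsometries X φ → 4 ≤ Module.finrank ℂ ↥(algebraicClasses X 1) →
          HodgeConjectureFor 4 X := by
  intro _ _ _ X hX hK φ P z hM hSp h4
  exact hodgeConjectureFor_of_spannedByIsometries_of_four_le hP hB hρ hMk hcup hBu hX hK hM h4 hSp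

end Summit.HodgeConjecture.HodgeConjecture.Theorems.MarkmanPartnerTransport.PartnerLattice

end
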